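import Mathlib.Analysis.ODE.ExistUnique

/-!
# The "source outside the transfer matrix" Carleman embedding misses the solution (DEQ-A116 support)

HONEST FRAMING: instance-level adjudication of specific advantage claims; no claim about
BQP vs BPP or the summit.

Lockwood–Wiebe–Johnson–Mülmenstädt–Chun–Schenter–Cheung–Li (arXiv:2509.20668v1, §III A, PDF
pp. 17–18, eqs. (55)–(65), and Appendix C (C20)) linearise `Ẏ = F₀ + F₁Y + Σ_{j≥2} F_jY^{⊗j}` by the
truncated Carleman system of the SOURCE-FREE equation (block upper-triangular transfer matrix
`M_k`, blocks `Z_i ≈ Y^{⊗i}`, no `F₀`-blocks below the diagonal) and then add the source only to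
the first block: `Ż = M_k Z + (F₀, 0, …, 0)` (their eq. (64): `B = F₀ ⊕ 0`); they state that "proof
of convergence for this method is an open question" (PDF p. 17, lines 14–19 of the text layer).
The structural fact recorded here settles it in the negative, modulo the (standard) convergence
of the source-free truncation: write the modified system as `z' = f₀ + A z + C w`, `w' = D w`
with `z = Z₁` (block 1), `w = (Z₂, …, Z_k)` (the remaining blocks,
which form a CLOSED source-free linear system because every block of `M_k` maps degree `≥ i` to
degree `i`), `A = F₁`, `C = (F₂ … F_k)` restricted to row 1, `f₀ = F₀`.  Then (this file, no
`sorry`):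
the blocks `w` coincide with those of the same system WITHOUT source (`zh, wh`, i.e. the truncated
Carleman system of the source-free equation from the same data), and the first block is
`z = zh + r` where `r' = f₀ + A r`, `r(0) = 0` is the response of the LINEARISED equation to the
source
(`block_one_eq_sourceFree_add_linearResponse`).  Consequently, whenever the source-free truncation
`zh` converges (as `k → ∞`) to the source-free nonlinear flow `w_sf(t)` — the regime of
[LiuEtAl2021Carleman, Cor. 1]
(`Literature.Analysis.ODE.Carleman.truncation_error_first_le_of_R_lt_one` in the scalar case) —
the modified scheme converges to `w_sf + r`, which solves
`v' = F₀ + F₁v + N(w_sf)` and differs from `Y` unless `N(Y) ≡ N(w_sf)` along the trajectory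
(`limit_eq_solution_iff`); the
error has a `k`-independent floor, first order in the nonlinearity (DEQ-A116 §4, Theorem A116-B,
with the two-implementation numerics of NUMERICS-A116).  The standard embedding
([LiuEtAl2021Carleman, eq. (3.3)]; [ForetsPouly2017, §3]) has the sub-diagonal blocks
`Σ_ν I ⊗ ⋯ ⊗ F₀ ⊗ ⋯ ⊗ I` and is consistent to order `k`.  Only Picard–Lindelöf uniqueness for
constant-coefficient linear systems is used (Mathlib `ODE_solution_unique_univ`).
-/

open Set

namespace Summit.QuantumAdvantage.Dequantization.CarlemanSourceOutside

variable {E W : Type*} [NormedAddCommGroup E] [NormedSpace ℝ E]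
  [NormedAddCommGroup W] [NormedSpace ℝ W]

/-- Uniqueness for the homogeneous constant-coefficient linear ODE: a global solution of
`e' = A e` vanishing at one time vanishes identically (Mathlib `ODE_solution_unique_univ` with the
Lipschitz constant `‖A‖`). [folklore] -/
theorem eq_zero_of_hasDerivAt_clm (A : E →L[ℝ] E) {e : ℝ → E}
    (he : ∀ t, HasDerivAt e (A (e t)) t) {t₀ : ℝ} (h0 : e t₀ = 0) : e = 0 := by
  have hg : ∀ t, HasDerivAt (fun _ : ℝ => (0 : E)) (A ((fun _ : ℝ => (0 : E)) t)) t ∧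
      (fun _ : ℝ => (0 : E)) t ∈ (univ : Set E) := fun t =>
    ⟨by simpa only [map_zero] using hasDerivAt_const t (0 : E), mem_univ _⟩
  have key := ODE_solution_unique_univ (v := fun _ x => A x) (s := fun _ => (univ : Set E))
    (K := ‖A‖₊) (f := e) (g := fun _ => (0 : E)) (t₀ := t₀)
    (fun _ => A.lipschitz.lipschitzOnWith) (fun t => ⟨he t, mem_univ _⟩) hg h0
  exact key

/-- **The modified ("source outside the transfer matrix") truncated Carleman system decomposes as
source-free truncation + linear response.**  Let `A : E →L E`, `C : W →L E`, `D : W →L W`, `f₀ : E`.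
If `(z, w)` solves `z' = f₀ + A z + C w`, `w' = D w` (the modified system: block 1 and the closed,
source-free remaining blocks), `(zh, wh)` solves the same system with `f₀ = 0` from the same initial
data, and `r` solves `r' = f₀ + A r`, `r 0 = 0`, then `w = wh` and `z = zh + r`: the source enters
the first block only through the response of the LINEARISED dynamics, never through the nonlinear
couplings `C, D` — whence the `k`-independent error floor of DEQ-A116 Theorem A116-B.
[new; elementary — with the module docstring it answers the convergence question left open at
arXiv:2509.20668v1 PDF p. 17 in the negative] -/
theorem block_one_eq_sourceFree_add_linearResponse
    (A : E →L[ℝ] E) (C : W →L[ℝ] E) (D : W →L[ℝ] W) (f₀ : E)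
    {z zh r : ℝ → E} {w wh : ℝ → W}
    (hz : ∀ t, HasDerivAt z (f₀ + A (z t) + C (w t)) t)
    (hw : ∀ t, HasDerivAt w (D (w t)) t)
    (hzh : ∀ t, HasDerivAt zh (A (zh t) + C (wh t)) t)
    (hwh : ∀ t, HasDerivAt wh (D (wh t)) t)
    (hr : ∀ t, HasDerivAt r (f₀ + A (r t)) t)
    (h0z : z 0 = zh 0) (h0w : w 0 = wh 0) (h0r : r 0 = 0) :
    w = wh ∧ z = zh + r := by
  -- the remaining blocks do not see the source: `w - wh` solves the homogeneous system from `0`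
  have hw' : w = wh := by
    have key := eq_zero_of_hasDerivAt_clm D (e := w - wh)
      (fun t => by simpa only [map_sub, Pi.sub_apply] using (hw t).sub (hwh t)) (t₀ := 0)
      (by simp [h0w])
    funext t
    have := congrFun key t
    simpa [sub_eq_zero] using this
  refine ⟨hw', ?_⟩
  -- block 1: `z - zh - r` solves `e' = A e` from `0`
  have he : ∀ t, HasDerivAt (fun t => z t - zh t - r t) (A (z t - zh t - r t)) t := by
    intro t
    have h := ((hz t).sub (hzh t)).sub (hr t)
    refine h.congr_deriv ?_
    rw [hw', map_sub, map_sub]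
    abel
  have key := eq_zero_of_hasDerivAt_clm A he (t₀ := 0) (by simp [h0z, h0r])
  funext t
  have := congrFun key t
  have h' : z t - zh t - r t = 0 := by simpa only [Pi.zero_apply] using this
  rw [Pi.add_apply]
  rw [sub_sub, sub_eq_zero] at h'
  exact h'

/-- **When is the limit of the modified scheme the true solution?**  Let `Y` solve the full
equation `Y' = f₀ + A Y + N_Y(t)` (with `N_Y(t)` the value of the nonlinear terms along `Y`), let
`wsf` solve the source-free equation `wsf' = A wsf + N_w(t)` from the same initial value, and let
`r' = f₀ + A r`, `r 0 = 0`.  Then the limit `wsf + r` of the modified scheme (previous theorem)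
equals `Y` if and only if the nonlinear terms take the same values along `Y` and along the
source-free flow, `N_Y = N_w` — which fails for a generic source `f₀ ≠ 0` (DEQ-A116 Theorem
A116-B(iv): the defect `Y - (wsf + r)` solves `δ' = A δ + (N_Y - N_w)`, `δ(0) = 0`, and is first
order in the nonlinearity).  (`→`: derivatives of the zero function vanish, `HasDerivAt.unique`;
`←`: linear uniqueness.) [new; elementary] -/
theorem limit_eq_solution_iff (A : E →L[ℝ] E) (f₀ : E) {Y wsf r NY Nw : ℝ → E}
    (hY : ∀ t, HasDerivAt Y (f₀ + A (Y t) + NY t) t)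
    (hwsf : ∀ t, HasDerivAt wsf (A (wsf t) + Nw t) t)
    (hr : ∀ t, HasDerivAt r (f₀ + A (r t)) t)
    (h0 : Y 0 = wsf 0) (h0r : r 0 = 0) :
    Y = wsf + r ↔ NY = Nw := by
  constructor
  · intro hYeq
    funext t
    have hδ : HasDerivAt (fun t => Y t - wsf t - r t)
        (A (Y t - wsf t - r t) + (NY t - Nw t)) t := by
      have h := ((hY t).sub (hwsf t)).sub (hr t)
      refine h.congr_deriv ?_
      rw [map_sub, map_sub]
      abel
    have hzero : (fun t => Y t - wsf t - r t) = fun _ => (0 : E) := by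
      funext s
      rw [hYeq, Pi.add_apply]
      abel
    have hval : Y t - wsf t - r t = 0 := by simpa only using congrFun hzero t
    have hδ0 : HasDerivAt (fun _ => (0 : E)) (A (Y t - wsf t - r t) + (NY t - Nw t)) t := by
      rw [← hzero]
      exact hδ
    have huniq := hδ0.unique (hasDerivAt_const t (0 : E))
    rw [hval, map_zero, zero_add, sub_eq_zero] at huniq
    exact huniq
  · intro hN
    have he : ∀ t, HasDerivAt (fun t => Y t - wsf t - r t) (A (Y t - wsf t - r t)) t := by
      intro t
      have h := ((hY t).sub (hwsf t)).sub (hr t)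
      refine h.congr_deriv ?_
      rw [hN, map_sub, map_sub]
      abel
    have key := eq_zero_of_hasDerivAt_clm A he (t₀ := 0) (by simp [h0, h0r])
    funext t
    have h' : Y t - wsf t - r t = 0 := by simpa only [Pi.zero_apply] using congrFun key t
    rw [Pi.add_apply]
    rw [sub_sub, sub_eq_zero] at h'
    exact h'

end Summit.QuantumAdvantage.Dequantization.CarlemanSourceOutside
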